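import Summits.Ventures.CertifiedManyBodySolver.Downfold.EmeryFermiFillingLSCOSubs
import Summits.Ventures.CertifiedManyBodySolver.Downfold.EmeryFermiFillingLa214
import Summits.Ventures.CertifiedManyBodySolver.Downfold.EmeryBoxesLa214V123
import HarnessLib

/-!
# La₂₋ₓSrₓCuO₄: the x = 1/8 (M15) and x = 0 (M13, v1.23 companion) 3BE boxes of record ⇒ CERTIFIED object-E Fermi-surface `t′/t`
# windows at the boxes' own hole counts — the doping lever of the three-band → one-band FS shape, kernel-checked

Venture CertifiedManyBodySolver, cell `pub/hubbard-downfold` (stage S1, HUMAN RULINGS D-0096/D-0098), seat hubbard-downfold-mod-4 (technique B);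
namespace `Summit.Ventures.CertifiedManyBodySolver.Downfold.Emery`. Everything PROVED; numerics decided by the kernel (`EmeryFermiFillingLSCOSubs`,
`EmeryFermiFillingLa214Subs`).

THE STATEMENTS.
* x = 1/8 (`emeryBoxLa214M15v123`, `EmeryBoxesLa214V123` §4; one-body rows of the La-214 3BE companion, n_H ∈ [1.105, 1.145]): at every parameter vector
  and every Fermi energy with `abFilling(ε) = (2 − n_H)/2`: **`t′/t ∈ [-0.2964, -0.1661]`**, ε_F ∈ [1.08, 2.48] eV above ε_d
  (`emeryBoxLa214M15v123_fsRatio_window`; transferred to `emeryBoxLa214M15v122` / `emeryBoxLa214M15` by refinement).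
* x = 0 on the companion OF RECORD `emeryBoxLa214v123` (n_H = 1): `t′/t ∈ [−0.2955, −0.1653]`, ε_F ∈ [1.14, 2.62] — the `EmeryFermiFillingLa214` word
  re-based from v1.22 to v1.23 (same one-body rows), in both forms (filling row `[0.495, 0.505]` and `abFilling = (2 − n_H)/2`).

READING — THE DOPING LEVER IS NIL AT THE σ LEVEL (certified, hull vs hull on the same parameter box): x = 0 → 1/8 moves the σ-model FS window
from [−0.2955, −0.1653] to [-0.2964, -0.1661], and every one of the sixteen sub-box windows by ≤ 0.002, while the certified ε_F brackets drop by
0.06–0.16 eV: the exact-contour `t′/t` of the σ model is RIGID under hole doping to 2·10⁻³ over the whole companion box (weak energy dependence of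
`fsRatio`, the kernel face of `EmeryFermiSurfaceDoping` with the filling map now closed). Consequently any printed doping dependence of a one-band
Fermi-surface `t′/t` (box #18's INFL-dop rows, charged-cell refits) is NOT a σ-band-structure effect. The object-E row of record is the same
[−0.30, −0.20] for M13 and M15 (`BoxesLa214*`), so INFL-3to1-B(t′/t of E) reads the same at x = 1/8 as at x = 0: covered from below
(-0.2964 vs −0.30), exceeded above (-0.1661 vs −0.20).

WHAT THIS IS NOT: SCREENING-GRADE boxes in, certified REDUCTION STEP out; rigid one-body rows across doping are the box's convention (the 3BE companion is
shared by the family), not a claim; not the U reduction; no phase sentence. Sources: [HybertsenSchluterChristensen1989, Eq. (1)]; [AndersenEtAl1995, §6].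
-/

noncomputable section

namespace Summit.Ventures.CertifiedManyBodySolver.Downfold.Emery

open Real Set
open Summit.Ventures.CertifiedManyBodySolver.Downfold

/-- Per-spin antibonding filling of the M15 hole count: `n_H ∈ [221/200, 229/200] ⇒ (2 − n_H)/2 ∈ [171/400, 179/400]`. [folklore] -/
theorem abFilling_rowM15_of_nHoles {nH f : ℝ} (h1 : (221 / 200 : ℝ) ≤ nH) (h2 : nH ≤ (229 / 200 : ℝ)) (hf : f = (2 - nH) / 2) :
    f ∈ Set.Icc (171 / 400 : ℝ) (179 / 400) := by
  rw [hf]; constructor <;> linarith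

/-- **LSCO x = 1/8: 3BE box ⇒ object-E `t′/t` window (raw coordinates)** at per-spin filling ∈ [0.4275, 0.4475]:
`ε ∈ [1.08, 2.48]` and `t′/t ∈ [-0.2964, -0.1661]`. [folklore] -/
theorem lscoBox_fsRatio_window {Δ tpd tpp c ε : ℝ} (hΔ : Δ ∈ Set.Icc (17 / 10 : ℝ) (4 : ℝ))
    (ha : tpd ∈ Set.Icc (129 / 100 : ℝ) (38 / 25 : ℝ)) (hb : tpp ∈ Set.Icc (23 / 50 : ℝ) (33 / 50 : ℝ))
    (hc : c ∈ Set.Icc (3 / 25 : ℝ) (3 / 20 : ℝ))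
    (hν : abFilling Δ tpd tpp c ε ∈ Set.Icc (171 / 400 : ℝ) (179 / 400)) :
    ε ∈ Set.Icc (27 / 25 : ℝ) (62 / 25 : ℝ) ∧ fsRatio Δ tpd tpp c ε ∈ Set.Icc (-(741 / 2500 : ℝ)) (-(1661 / 10000 : ℝ)) := by
  have hΔ' := hΔ
  constructor
  · clear hΔ
    rcases mem_Icc_split hΔ' (57 / 20 : ℝ) with hΔ' | hΔ'
    · rcases mem_Icc_split hΔ' (91 / 40 : ℝ) with hΔ' | hΔ'
      · rcases mem_Icc_split hΔ' (159 / 80 : ℝ) with hΔ' | hΔ'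
        · rcases mem_Icc_split ha (281 / 200 : ℝ) with ha' | ha'
          · have h := (lscoSub_0_0 hΔ' ha' hb hc hν).1
            exact ⟨le_trans (by norm_num) h.1, h.2.trans (by norm_num)⟩
          · have h := (lscoSub_0_1 hΔ' ha' hb hc hν).1
            exact ⟨le_trans (by norm_num) h.1, h.2.trans (by norm_num)⟩
        · rcases mem_Icc_split ha (281 / 200 : ℝ) with ha' | ha'
          · have h := (lscoSub_1_0 hΔ' ha' hb hc hν).1
            exact ⟨le_trans (by norm_num) h.1, h.2.trans (by norm_num)⟩
          · have h := (lscoSub_1_1 hΔ' ha' hb hc hν).1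
            exact ⟨le_trans (by norm_num) h.1, h.2.trans (by norm_num)⟩
      · rcases mem_Icc_split hΔ' (41 / 16 : ℝ) with hΔ' | hΔ'
        · rcases mem_Icc_split ha (281 / 200 : ℝ) with ha' | ha'
          · have h := (lscoSub_2_0 hΔ' ha' hb hc hν).1
            exact ⟨le_trans (by norm_num) h.1, h.2.trans (by norm_num)⟩
          · have h := (lscoSub_2_1 hΔ' ha' hb hc hν).1
            exact ⟨le_trans (by norm_num) h.1, h.2.trans (by norm_num)⟩
        · rcases mem_Icc_split ha (281 / 200 : ℝ) with ha' | ha'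
          · have h := (lscoSub_3_0 hΔ' ha' hb hc hν).1
            exact ⟨le_trans (by norm_num) h.1, h.2.trans (by norm_num)⟩
          · have h := (lscoSub_3_1 hΔ' ha' hb hc hν).1
            exact ⟨le_trans (by norm_num) h.1, h.2.trans (by norm_num)⟩
    · rcases mem_Icc_split hΔ' (137 / 40 : ℝ) with hΔ' | hΔ'
      · rcases mem_Icc_split hΔ' (251 / 80 : ℝ) with hΔ' | hΔ'
        · rcases mem_Icc_split ha (281 / 200 : ℝ) with ha' | ha'
          · have h := (lscoSub_4_0 hΔ' ha' hb hc hν).1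
            exact ⟨le_trans (by norm_num) h.1, h.2.trans (by norm_num)⟩
          · have h := (lscoSub_4_1 hΔ' ha' hb hc hν).1
            exact ⟨le_trans (by norm_num) h.1, h.2.trans (by norm_num)⟩
        · rcases mem_Icc_split ha (281 / 200 : ℝ) with ha' | ha'
          · have h := (lscoSub_5_0 hΔ' ha' hb hc hν).1
            exact ⟨le_trans (by norm_num) h.1, h.2.trans (by norm_num)⟩
          · have h := (lscoSub_5_1 hΔ' ha' hb hc hν).1
            exact ⟨le_trans (by norm_num) h.1, h.2.trans (by norm_num)⟩
      · rcases mem_Icc_split hΔ' (297 / 80 : ℝ) with hΔ' | hΔ'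
        · rcases mem_Icc_split ha (281 / 200 : ℝ) with ha' | ha'
          · have h := (lscoSub_6_0 hΔ' ha' hb hc hν).1
            exact ⟨le_trans (by norm_num) h.1, h.2.trans (by norm_num)⟩
          · have h := (lscoSub_6_1 hΔ' ha' hb hc hν).1
            exact ⟨le_trans (by norm_num) h.1, h.2.trans (by norm_num)⟩
        · rcases mem_Icc_split ha (281 / 200 : ℝ) with ha' | ha'
          · have h := (lscoSub_7_0 hΔ' ha' hb hc hν).1
            exact ⟨le_trans (by norm_num) h.1, h.2.trans (by norm_num)⟩
          · have h := (lscoSub_7_1 hΔ' ha' hb hc hν).1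
            exact ⟨le_trans (by norm_num) h.1, h.2.trans (by norm_num)⟩
  · clear hΔ
    rcases mem_Icc_split hΔ' (57 / 20 : ℝ) with hΔ' | hΔ'
    · rcases mem_Icc_split hΔ' (91 / 40 : ℝ) with hΔ' | hΔ'
      · rcases mem_Icc_split hΔ' (159 / 80 : ℝ) with hΔ' | hΔ'
        · rcases mem_Icc_split ha (281 / 200 : ℝ) with ha' | ha'
          · have h := (lscoSub_0_0 hΔ' ha' hb hc hν).2
            exact ⟨le_trans (by norm_num) h.1, h.2.trans (by norm_num)⟩
          · have h := (lscoSub_0_1 hΔ' ha' hb hc hν).2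
            exact ⟨le_trans (by norm_num) h.1, h.2.trans (by norm_num)⟩
        · rcases mem_Icc_split ha (281 / 200 : ℝ) with ha' | ha'
          · have h := (lscoSub_1_0 hΔ' ha' hb hc hν).2
            exact ⟨le_trans (by norm_num) h.1, h.2.trans (by norm_num)⟩
          · have h := (lscoSub_1_1 hΔ' ha' hb hc hν).2
            exact ⟨le_trans (by norm_num) h.1, h.2.trans (by norm_num)⟩
      · rcases mem_Icc_split hΔ' (41 / 16 : ℝ) with hΔ' | hΔ'
        · rcases mem_Icc_split ha (281 / 200 : ℝ) with ha' | ha'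
          · have h := (lscoSub_2_0 hΔ' ha' hb hc hν).2
            exact ⟨le_trans (by norm_num) h.1, h.2.trans (by norm_num)⟩
          · have h := (lscoSub_2_1 hΔ' ha' hb hc hν).2
            exact ⟨le_trans (by norm_num) h.1, h.2.trans (by norm_num)⟩
        · rcases mem_Icc_split ha (281 / 200 : ℝ) with ha' | ha'
          · have h := (lscoSub_3_0 hΔ' ha' hb hc hν).2
            exact ⟨le_trans (by norm_num) h.1, h.2.trans (by norm_num)⟩
          · have h := (lscoSub_3_1 hΔ' ha' hb hc hν).2
            exact ⟨le_trans (by norm_num) h.1, h.2.trans (by norm_num)⟩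
    · rcases mem_Icc_split hΔ' (137 / 40 : ℝ) with hΔ' | hΔ'
      · rcases mem_Icc_split hΔ' (251 / 80 : ℝ) with hΔ' | hΔ'
        · rcases mem_Icc_split ha (281 / 200 : ℝ) with ha' | ha'
          · have h := (lscoSub_4_0 hΔ' ha' hb hc hν).2
            exact ⟨le_trans (by norm_num) h.1, h.2.trans (by norm_num)⟩
          · have h := (lscoSub_4_1 hΔ' ha' hb hc hν).2
            exact ⟨le_trans (by norm_num) h.1, h.2.trans (by norm_num)⟩
        · rcases mem_Icc_split ha (281 / 200 : ℝ) with ha' | ha'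
          · have h := (lscoSub_5_0 hΔ' ha' hb hc hν).2
            exact ⟨le_trans (by norm_num) h.1, h.2.trans (by norm_num)⟩
          · have h := (lscoSub_5_1 hΔ' ha' hb hc hν).2
            exact ⟨le_trans (by norm_num) h.1, h.2.trans (by norm_num)⟩
      · rcases mem_Icc_split hΔ' (297 / 80 : ℝ) with hΔ' | hΔ'
        · rcases mem_Icc_split ha (281 / 200 : ℝ) with ha' | ha'
          · have h := (lscoSub_6_0 hΔ' ha' hb hc hν).2
            exact ⟨le_trans (by norm_num) h.1, h.2.trans (by norm_num)⟩
          · have h := (lscoSub_6_1 hΔ' ha' hb hc hν).2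
            exact ⟨le_trans (by norm_num) h.1, h.2.trans (by norm_num)⟩
        · rcases mem_Icc_split ha (281 / 200 : ℝ) with ha' | ha'
          · have h := (lscoSub_7_0 hΔ' ha' hb hc hν).2
            exact ⟨le_trans (by norm_num) h.1, h.2.trans (by norm_num)⟩
          · have h := (lscoSub_7_1 hΔ' ha' hb hc hν).2
            exact ⟨le_trans (by norm_num) h.1, h.2.trans (by norm_num)⟩

/-- The five rows of `emeryBoxLa214M15v123` this file reads (one-body rows = the v1.23 companion's; n_H = `la214M15Emery_nH`). [folklore] -/
theorem emeryBoxLa214M15v123_mem_rows {p : EmeryCoord → ℝ} (hp : emeryBoxLa214M15v123.Mem p) :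
    p .DeltaPd ∈ Set.Icc (17 / 10 : ℝ) 4 ∧ p .tpd ∈ Set.Icc (129 / 100 : ℝ) (38 / 25) ∧
      p .tpp ∈ Set.Icc (23 / 50 : ℝ) (33 / 50) ∧ p .tppP ∈ Set.Icc (3 / 25 : ℝ) (3 / 20) ∧
      p .nHoles ∈ Set.Icc (221 / 200 : ℝ) (229 / 200) := by
  obtain ⟨etpd, etpp, eΔ, -, -, enH⟩ := emeryBoxLa214M15v123_entries
  have etppP : emeryBoxLa214M15v123 .tppP = some la214Emery_tppP := by
    simp [emeryBoxLa214M15v123, emeryBoxLa214v123, Function.update]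
  have hΔ := (Entry.mem_ofEnds_iff _ _ _ _ _).1 (hp .DeltaPd la214Emery_Delta eΔ)
  have ha := (Entry.mem_ofEnds_iff _ _ _ _ _).1 (hp .tpd la214Emery_tpd etpd)
  have hb := (Entry.mem_ofEnds_iff _ _ _ _ _).1 (hp .tpp la214Emery_tpp etpp)
  have hc := (Entry.mem_ofEnds_iff _ _ _ _ _).1 (hp .tppP la214Emery_tppP etppP)
  have hn := (Entry.mem_ofEnds_iff _ _ _ _ _).1 (hp .nHoles la214M15Emery_nH enH)
  push_cast at hΔ ha hb hc hn
  exact ⟨⟨hΔ.1, hΔ.2⟩, ⟨ha.1, ha.2⟩, ⟨hb.1, hb.2⟩, ⟨hc.1, hc.2⟩, ⟨hn.1, hn.2⟩⟩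

/-- **THE WORD ON THE TYPED x = 1/8 BOX OF RECORD `emeryBoxLa214M15v123`**: at every parameter vector and every Fermi energy at which the
σ-model antibonding band holds the box's own electron count, `ε ∈ [1.08, 2.48]` and the exact σ-model Fermi-surface `t′/t ∈ [-0.2964, -0.1661]`.
[cite: HybertsenSchluterChristensen1989, Eq. (1) (three-band d–p model)] -/
theorem emeryBoxLa214M15v123_fsRatio_window :
    HoldsOn (fun p : EmeryCoord → ℝ => ∀ ε : ℝ,
      abFilling (p .DeltaPd) (p .tpd) (p .tpp) (p .tppP) ε = (2 - p .nHoles) / 2 →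
      ε ∈ Set.Icc (27 / 25 : ℝ) (62 / 25 : ℝ) ∧
      fsRatio (p .DeltaPd) (p .tpd) (p .tpp) (p .tppP) ε ∈ Set.Icc (-(741 / 2500 : ℝ)) (-(1661 / 10000 : ℝ))) emeryBoxLa214M15v123 := by
  intro p hp ε hf
  obtain ⟨hΔ, ha, hb, hc, hn⟩ := emeryBoxLa214M15v123_mem_rows hp
  exact lscoBox_fsRatio_window hΔ ha hb hc (abFilling_rowM15_of_nHoles hn.1 hn.2 hf)

/-- The same word on `emeryBoxLa214M15v122` (⊑ v1.23). [folklore] -/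
theorem emeryBoxLa214M15v122_fsRatio_window :
    HoldsOn (fun p : EmeryCoord → ℝ => ∀ ε : ℝ,
      abFilling (p .DeltaPd) (p .tpd) (p .tpp) (p .tppP) ε = (2 - p .nHoles) / 2 →
      ε ∈ Set.Icc (27 / 25 : ℝ) (62 / 25 : ℝ) ∧
      fsRatio (p .DeltaPd) (p .tpd) (p .tpp) (p .tppP) ε ∈ Set.Icc (-(741 / 2500 : ℝ)) (-(1661 / 10000 : ℝ))) emeryBoxLa214M15v122 :=
  holdsOn_emeryBoxLa214M15v122_of_v123 emeryBoxLa214M15v123_fsRatio_window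

/-- The same word on the pre-v1.18 x = 1/8 box `emeryBoxLa214M15` (⊑ v1.23). [folklore] -/
theorem emeryBoxLa214M15_fsRatio_window :
    HoldsOn (fun p : EmeryCoord → ℝ => ∀ ε : ℝ,
      abFilling (p .DeltaPd) (p .tpd) (p .tpp) (p .tppP) ε = (2 - p .nHoles) / 2 →
      ε ∈ Set.Icc (27 / 25 : ℝ) (62 / 25 : ℝ) ∧
      fsRatio (p .DeltaPd) (p .tpd) (p .tpp) (p .tppP) ε ∈ Set.Icc (-(741 / 2500 : ℝ)) (-(1661 / 10000 : ℝ))) emeryBoxLa214M15 :=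
  holdsOn_emeryBoxLa214M15_of_v123 emeryBoxLa214M15v123_fsRatio_window

/-! ## The x = 0 word re-based on the v1.23 companion of record -/

/-- **x = 0 on `emeryBoxLa214v123` (filling-row form)**: at n/2 ∈ [0.495, 0.505] the σ-model FS `t′/t ∈ [−0.2955, −0.1653]`
(`la214Box_fsRatio_window`; the v1.23 re-issue touched interaction rows only). [folklore] -/
theorem emeryBoxLa214v123_fsRatio_window :
    HoldsOn (fun p : EmeryCoord → ℝ => ∀ ε : ℝ,
      abFilling (p .DeltaPd) (p .tpd) (p .tpp) (p .tppP) ε ∈ Set.Icc (99 / 200 : ℝ) (101 / 200) →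
      fsRatio (p .DeltaPd) (p .tpd) (p .tpp) (p .tppP) ε ∈ Set.Icc (-(591 / 2000 : ℝ)) (-(1653 / 10000 : ℝ))) emeryBoxLa214v123 := by
  intro p hp ε hν
  obtain ⟨h1, h2, h3, h4, h5, h6, h7, h8, -⟩ := (emeryBoxLa214v123_mem_iff p).1 hp
  push_cast at h1 h2 h3 h4 h5 h6 h7 h8
  exact la214Box_fsRatio_window ⟨h1, h2⟩ ⟨h3, h4⟩ ⟨h5, h6⟩ ⟨h7, h8⟩ hν

/-- **x = 0 on `emeryBoxLa214v123` (hole-count form)**: at the box's own electron count (`n_H = 1` ⇒ `abFilling = 1/2`) the σ-model FS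
`t′/t ∈ [−0.2955, −0.1653]`. [folklore] -/
theorem emeryBoxLa214v123_fsRatio_window_nH :
    HoldsOn (fun p : EmeryCoord → ℝ => ∀ ε : ℝ,
      abFilling (p .DeltaPd) (p .tpd) (p .tpp) (p .tppP) ε = (2 - p .nHoles) / 2 →
      fsRatio (p .DeltaPd) (p .tpd) (p .tpp) (p .tppP) ε ∈ Set.Icc (-(591 / 2000 : ℝ)) (-(1653 / 10000 : ℝ))) emeryBoxLa214v123 := by
  intro p hp ε hf
  obtain ⟨h1, h2, h3, h4, h5, h6, h7, h8, -, -, -, -, -, -, hn1, hn2⟩ := (emeryBoxLa214v123_mem_iff p).1 hp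
  push_cast at h1 h2 h3 h4 h5 h6 h7 h8 hn1 hn2
  refine la214Box_fsRatio_window ⟨h1, h2⟩ ⟨h3, h4⟩ ⟨h5, h6⟩ ⟨h7, h8⟩ ?_
  rw [hf]; constructor <;> linarith

end Summit.Ventures.CertifiedManyBodySolver.Downfold.Emery
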